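import Summits.QuantumFields.BalabanUV.Beta.D1BFx.LamGroupPointwise

/-!
# `BalabanUV.Beta.D1BFx.NeedleGroupPointwise` — road «BF-x» for binder row D1, slot (K), census group **NEEDLES ∪ G_R** (`hGrp gN` of the END of record
# `RoadEndBFxTotalShellGroups.d1Drift_BFx_total_shell_of_prop12_of_groups`, p252741): THE NEEDLE GROUP OF RE-CUT REST WORDS, SUMMED AT A FIXED BASE SITE AND
# DISPLACEMENT, IS THREE GLUON TWO-SECTOR TABLES + THREE GHOST TWO-SECTOR TABLES + ONE SLOT-4 TADPOLE, EACH OVER THE FULL LEG — owner d1-p2-g9's (N-0)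
# «NEEDLE-POINTWISE» (`NEEDLE-BOUND-NOTES.md` v1 §5; journal 2026-08-21 l.28939), the twin of `LamGroupPointwise` (p253437) for the needle fibre

HONEST DEPENDENCY (page 1, mandatory): continuum YM on T⁴ ⇐ BetaPertH ∧ nine spine estimates (0/9 proved); BetaPertH ⇐ (D1) ∧ (D4) ∧
CAP+tail; G-an2-4 gates asym, D1 and NE2/3/4.  HONEST FRAMING (cell contract, verbatim): «discharging `BetaPertH` makes Bałaban's UV
stability UNCONDITIONAL — a real constructive-QFT result; it is NOT the continuum limit and NOT the Clay problem.»  THIS MODULE DISCHARGES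
NOTHING of the wall: THREE definitions with a body ([our object] `needleBub`, `needleGhBub`, `needleFibre` — the finite index set of the needle group as DATA)
and [folklore] finite-sum bookkeeping BY NAME over `SplitRecut.restK'_bub`∕`restK'_gbub`∕`restK'_tad`, the leg recombinations
`FineHessianLegGrades.biBubbleTable_Ga_eq_pieceSum`∕`tadpoleTable_eq_pieceSum` (`SectorRecut.loc_secSt'`) and `FineHessianGhostGrades.biBubbleTable_Ggh_eq_pieceSum`
(`loc_ghSec`).  No `Prop` minted, nothing cited, no hypothesis is a printed statement, 0 sorry.  NO bound, NO estimate: the (N) row's constant `C_N` is (N-1)∕(N-2)'s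
business.  0 wall binders; (K) NOT closed; NOT D1, NOT `BetaPertH`, NOT continuum, NOT Clay.

ABSOLUTE RULE (cell charter, verbatim): «No internally-minted statement may enter as a cited fact. Every hypothesis is either kernel-proved in
this package or a verbatim quotation of a PUBLISHED theorem with page reference. The manuscript(s) under audit are NOT citable for their own
disputed steps — they are the thing under adjudication; programme-internal (2001/route/tribunal) claims are never citable.»

CONTENT.
* §1 [our object] **`needleBub`** (gluon bubble indices `(s, s′, r, r′)` with an `SbRc` vertex and no Λ vertex: `(s = 2 ∨ s′ = 2) ∧ s ≠ 1 ∧ s′ ≠ 1`; 27),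
  **`needleGhBub`** (ghost bubble indices `(i, j, r, r′)` with a `ghSec 1 = qAntiAt` vertex: `i = 1 ∨ j = 1`; 12), **`needleFibre`** (their images in `RestIdx` ∪ the
  three slot-4 `WQ` tadpole words `Sum.inl (4, r)`; 42 — the ghost TADPOLE words are NOT included); membership lemmas; `sum_needleFibre`; `disjoint_lamFibre_needleFibre`.
* §2 [folklore] `sum_needleBub_restK'`, `sum_needleGhBub_restK'`, `sum_needleTad_restK'`, **`sum_needleFibre_restK'`** — THE POINTWISE IDENTITY at `(b, w)` for ANY
  exponentially bounded profile `g`, `0 < a`, `Spr (Ga n a)`, the slot-4 table bi-localised (`hQ`, the END's socket): LEG RECOMBINATION ONLY — each needle word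
  becomes ONE two-sector table over the FULL gluon leg `Ga n a` ∕ ghost leg `Ggh n a`, the currency per-word superposition bounds consume.
* §3 (v1.1, APPEND-ONLY; owner ruling ρ-g9-26, journal 2026-08-21 l.28997) [our object] **`needleFibre'`** := `needleFibre` ∪ the two ghost TADPOLE words
  `Sum.inr (Sum.inr (Sum.inl r))` (44 words) — their table `GhostAveragingSquare.WghAt (ctrHalf n) n x₀ cK cQ = diagExt ((x₀·cK) • ghX) + (−(x₀·cQ·n⁴)) • qSqAt`
  carries the tower-side needle's averaging square `qSqAt = qAntiAt ⊗ qAntiAt` (weight `cQ`), hence belongs to the needle group (its bond-diagonal `ghX` part is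
  local and rides along); membership lemmas, `sum_needleFibre'`, `disjoint_lamFibre_needleFibre'`; [folklore] `sum_needleGhTad_restK'` (leg recombination of the
  two ghost tadpole words to the full ghost leg, `FineHessianGhostGrades.tadpoleTableA_Ggh_eq_pieceSum` with `loc_WghAt_ctr`) and **`sum_needleFibre'_restK'`** =
  `sum_needleFibre_restK'` + that eighth table.  THE NEEDLE FIBRE OF RECORD IS `needleFibre'`; LOCAL := complement of `lamFibre ∪ needleFibre' ∪ {corner}`.
Unit `b2b-balaban-gan24-formalise-leaf-05` (gen 40), G-an2-4 swarm leaf prover on cross-lane kernel duty for road «BF-x» (owner d1-p2; first refusal l.28939, MINE l.28965);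
§3 by the road OWNER `b2b-balaban-beta-d1-p2` (gen 9).
-/

noncomputable section

namespace Summit.QuantumFields.BalabanUV.Beta.D1BFx.NeedleGroupPointwise

open Finset
open scoped BigOperators
open Literature.MathematicalPhysics.QuantumFieldTheory.Balaban1983to89
open Literature.MathematicalPhysics.QuantumFieldTheory.Balaban1983to89.Beta
open B12Sec2to5 (l1)
open ExpKernelCalculus (Site MKer BiLoc)
open DyadicShell (Pt toReal)
open Summit.QuantumFields.BalabanUV.Beta.TameKernelCalculus (Spr Loc)
open Summit.QuantumFields.BalabanUV.Beta.D1BFx.MomentTransferPeriodic (baseKer)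
open Summit.QuantumFields.BalabanUV.Beta.D1BFx.GluonLeg (Ga)
open Summit.QuantumFields.BalabanUV.Beta.D1BFx.GhostLeg (Ggh)
open Summit.QuantumFields.BalabanUV.Beta.D1BFx.GhostStencil (ghCur)
open Summit.QuantumFields.BalabanUV.Beta.D1BFx.GhostStencilRooted (qAntiAt)
open Summit.QuantumFields.BalabanUV.Beta.D1BFx.GhostStencilRootedReflection (ctrHalf)
open Summit.QuantumFields.BalabanUV.Beta.D1BFx.ReducedKernel (StencilR TableR)
open Summit.QuantumFields.BalabanUV.Beta.D1BFx.DressedTadpoleTable (tadpoleTable tadpoleTable_apply)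
open Summit.QuantumFields.BalabanUV.Beta.D1BFx.DressedTablesLeg (tadpoleTableA)
open Summit.QuantumFields.BalabanUV.Beta.D1BFx.FineHessianSectors (biBubbleTable slotWt slotTab)
open Summit.QuantumFields.BalabanUV.Beta.D1BFx.FineHessianLegGrades (legPiece biBubbleTable_Ga_eq_pieceSum tadpoleTable_eq_pieceSum)
open Summit.QuantumFields.BalabanUV.Beta.D1BFx.FineHessianGhostGrades (ghSec ghWt ghLeg ghSec_zero ghSec_one ghWt_zero ghWt_one loc_ghSec biBubbleTable_Ggh_eq_pieceSum)
open Summit.QuantumFields.BalabanUV.Beta.D1BFx.SplitInstance (RestIdx sum4_prod)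
open Summit.QuantumFields.BalabanUV.Beta.D1BFx.SectorRecut (SbT SbRc secSt' secWt' secSt'_zero secSt'_one secSt'_two secWt'_zero secWt'_one secWt'_two loc_secSt')
open Summit.QuantumFields.BalabanUV.Beta.D1BFx.SplitRecut (restK' restK'_bub restK'_gbub restK'_tad)
open Summit.QuantumFields.BalabanUV.Beta.D1BFx.LamGroupPointwise (lamFibre mem_lamFibre_bub mem_lamFibre_tad not_mem_lamFibre_inr_inr)

/-! ## §1 The index set of the needle group -/

/-- [our object] The gluon bubble indices of the needle group: an `SbRc`-sector vertex and NO Λ-sector vertex (3 sector pairs × 9 leg grades = 27 words). -/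
def needleBub : Finset (Fin 3 × Fin 3 × Fin 3 × Fin 3) := univ.filter fun x => (x.1 = 2 ∨ x.2.1 = 2) ∧ x.1 ≠ 1 ∧ x.2.1 ≠ 1

/-- [our object] The ghost bubble indices of the needle group: a `ghSec 1 = qAntiAt` vertex (3 sector pairs × 4 leg grades = 12 words). -/
def needleGhBub : Finset (Fin 2 × Fin 2 × Fin 2 × Fin 2) := univ.filter fun x => x.1 = 1 ∨ x.2.1 = 1

/-- [our object] **THE INDEX SET OF THE NEEDLE GROUP OF RE-CUT REST WORDS** (owner (N-0): the coarse group NEEDLES ∪ G_R of SPEC «K-END-RESHAPE-GROUPS» §2):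
the 27 gluon bubble words `Sum.inr (Sum.inl x)`, `x ∈ needleBub`, the 12 ghost bubble words `Sum.inr (Sum.inr (Sum.inr (Sum.inl y)))`, `y ∈ needleGhBub`, and the
3 slot-4 tadpole words `Sum.inl (4, r)`.  A DEFINITION (data); the two ghost tadpole words are deliberately NOT included. -/
def needleFibre : Finset RestIdx :=
  needleBub.map ⟨fun x => Sum.inr (Sum.inl x), fun _ _ h => Sum.inl_injective (Sum.inr_injective h)⟩
    ∪ needleGhBub.map ⟨fun y => Sum.inr (Sum.inr (Sum.inr (Sum.inl y))),
        fun _ _ h => Sum.inl_injective (Sum.inr_injective (Sum.inr_injective (Sum.inr_injective h)))⟩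
    ∪ (univ : Finset (Fin 3)).map ⟨fun r => Sum.inl ((4 : Fin 5), r), fun _ _ h => (Prod.mk.inj (Sum.inl_injective h)).2⟩

/-- [our object] Membership: gluon bubble words. -/
theorem mem_needleFibre_bub (x : Fin 3 × Fin 3 × Fin 3 × Fin 3) :
    (Sum.inr (Sum.inl x) : RestIdx) ∈ needleFibre ↔ ((x.1 = 2 ∨ x.2.1 = 2) ∧ x.1 ≠ 1 ∧ x.2.1 ≠ 1) := by
  simp [needleFibre, needleBub]

/-- [our object] Membership: ghost bubble words. -/
theorem mem_needleFibre_gbub (y : Fin 2 × Fin 2 × Fin 2 × Fin 2) :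
    (Sum.inr (Sum.inr (Sum.inr (Sum.inl y))) : RestIdx) ∈ needleFibre ↔ (y.1 = 1 ∨ y.2.1 = 1) := by
  simp [needleFibre, needleGhBub]

/-- [our object] Membership: gluon tadpole words — exactly the slot-4 ones. -/
theorem mem_needleFibre_tad (x : Fin 5 × Fin 3) : (Sum.inl x : RestIdx) ∈ needleFibre ↔ x.1 = 4 := by
  obtain ⟨s, r⟩ := x
  constructor
  · intro h
    simp only [needleFibre, mem_union, mem_map, Function.Embedding.coeFn_mk, mem_univ, true_and] at h
    rcases h with (⟨_, _, h⟩ | ⟨_, _, h⟩) | ⟨r', h⟩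
    · cases h
    · cases h
    · exact (congrArg Prod.fst (Sum.inl_injective h)).symm
  · rintro (rfl : s = 4)
    simp only [needleFibre, mem_union, mem_map, Function.Embedding.coeFn_mk, mem_univ, true_and]
    exact Or.inr ⟨r, rfl⟩

/-- [our object] No ghost tadpole word and no corner∕cross word is in the needle group. -/
theorem not_mem_needleFibre_gtad (r : Fin 2) : (Sum.inr (Sum.inr (Sum.inl r)) : RestIdx) ∉ needleFibre := by
  simp [needleFibre]

/-- [our object] … corner∕cross words. -/
theorem not_mem_needleFibre_last (k : Fin 2) : (Sum.inr (Sum.inr (Sum.inr (Sum.inr k))) : RestIdx) ∉ needleFibre := by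
  simp [needleFibre]

/-- [folklore] **THE SUM OVER THE NEEDLE GROUP AS «27 GLUON BUBBLE WORDS + 12 GHOST BUBBLE WORDS + 3 TADPOLE WORDS».** -/
theorem sum_needleFibre (f : RestIdx → ℝ) :
    ∑ τ ∈ needleFibre, f τ = (∑ x ∈ needleBub, f (Sum.inr (Sum.inl x)))
      + (∑ y ∈ needleGhBub, f (Sum.inr (Sum.inr (Sum.inr (Sum.inl y))))) + ∑ r : Fin 3, f (Sum.inl ((4 : Fin 5), r)) := by
  rw [needleFibre, sum_union, sum_union, sum_map, sum_map, sum_map]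
  · rfl
  · rw [disjoint_left]
    intro τ h₁ h₂
    simp only [mem_map, Function.Embedding.coeFn_mk] at h₁ h₂
    obtain ⟨_, _, rfl⟩ := h₁
    obtain ⟨_, _, h⟩ := h₂
    cases h
  · rw [disjoint_left]
    intro τ h₁ h₂
    simp only [mem_union, mem_map, Function.Embedding.coeFn_mk, mem_univ, true_and] at h₁ h₂
    obtain ⟨_, h⟩ := h₂
    rcases h₁ with ⟨_, _, rfl⟩ | ⟨_, _, rfl⟩ <;> cases h

/-- [folklore] **THE Λ-GROUP AND THE NEEDLE GROUP ARE DISJOINT** (so one label `grp : RestIdx → Fin 4` can send them to different values). -/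
theorem disjoint_lamFibre_needleFibre : Disjoint lamFibre needleFibre := by
  rw [disjoint_left]
  intro τ h₁ h₂
  rcases τ with x | x | y
  · exact absurd ((mem_needleFibre_tad x).1 h₂) (by rw [(mem_lamFibre_tad x).1 h₁]; decide)
  · have h1 := (mem_lamFibre_bub x).1 h₁
    have h2 := (mem_needleFibre_bub x).1 h₂
    exact h1.elim (fun h => h2.2.1 h) (fun h => h2.2.2 h)
  · exact not_mem_lamFibre_inr_inr y h₁

/-! ## §2 The pointwise identity: leg recombination -/

section Pointwise

variable (n : ℕ) [NeZero n] (a : ℝ) {g : Pt → ℝ} (cE cΛ cR cK cQ cE₂ cJ4 cΛ₂ cR₂ cQ₂ x₀ : ℝ) (WE WJ WΛ WR WQ : TableR)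
  (ωgl ωgh lam N : ℝ) (μ ν : Fin 4) (b : Pt) {C δ CQ δW : ℝ}

/-- [folklore] Leg recombination for the 27 GLUON BUBBLE WORDS of the needle group at `(b, w)`: three two-sector tables over the full gluon leg,
`cE·(SbT ⊗ SbRc) + cE·(SbRc ⊗ SbT) + SbRc ⊗ SbRc`. -/
theorem sum_needleBub_restK' (ha : 0 < a) (hGa : Spr (Ga n a)) (hδ : 0 < δ) (hg : ∀ v, |g v| ≤ C * Real.exp (-δ * l1 v)) (w : Pt) :
    ∑ x ∈ needleBub, restK' n a g cE cΛ cR cK cQ cE₂ cJ4 cΛ₂ cR₂ cQ₂ x₀ WE WJ WΛ WR WQ ωgl ωgh lam N μ ν b (Sum.inr (Sum.inl x)) w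
      = ωgl * (((n : ℝ) ^ 8)⁻¹ * (toReal w μ * toReal w ν *
          (cE * biBubbleTable (Ga n a) (Ga n a) SbT (SbRc n a cE cR cK cQ) μ ν (b + w) b
            + cE * biBubbleTable (Ga n a) (Ga n a) (SbRc n a cE cR cK cQ) SbT μ ν (b + w) b
            + biBubbleTable (Ga n a) (Ga n a) (SbRc n a cE cR cK cQ) (SbRc n a cE cR cK cQ) μ ν (b + w) b))) := by
  have hloc : ∀ (s : Fin 3) (κ : Fin 4) (u : Site 4), Loc (secSt' n a cE cR cK cQ s κ u) := fun s κ u => loc_secSt' n a cE cR cK cQ ha s κ u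
  have hword : ∀ x ∈ needleBub, restK' n a g cE cΛ cR cK cQ cE₂ cJ4 cΛ₂ cR₂ cQ₂ x₀ WE WJ WΛ WR WQ ωgl ωgh lam N μ ν b (Sum.inr (Sum.inl x)) w
      = ωgl * (secWt' cE cΛ x.1 * secWt' cE cΛ x.2.1 * (((n : ℝ) ^ 8)⁻¹ * (toReal w μ * toReal w ν *
          biBubbleTable (legPiece n a g x.2.2.1) (legPiece n a g x.2.2.2) (secSt' n a cE cR cK cQ x.1) (secSt' n a cE cR cK cQ x.2.1) μ ν
            (b + w) b))) := by
    intro x hx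
    have hx' : (x.1 = 2 ∨ x.2.1 = 2) ∧ x.1 ≠ 1 ∧ x.2.1 ≠ 1 := (mem_filter.1 hx).2
    have hne : x ≠ ((0 : Fin 3), (0 : Fin 3), (0 : Fin 3), (0 : Fin 3)) := by
      rintro rfl
      rcases hx'.1 with h | h <;> exact absurd h (by decide)
    rw [restK'_bub, if_neg hne]
    rfl
  rw [sum_congr rfl hword]
  have hind : ∑ x ∈ needleBub, ωgl * (secWt' cE cΛ x.1 * secWt' cE cΛ x.2.1 * (((n : ℝ) ^ 8)⁻¹ * (toReal w μ * toReal w ν *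
          biBubbleTable (legPiece n a g x.2.2.1) (legPiece n a g x.2.2.2) (secSt' n a cE cR cK cQ x.1) (secSt' n a cE cR cK cQ x.2.1) μ ν
            (b + w) b)))
      = ∑ s : Fin 3, ∑ s' : Fin 3, if ((s = 2 ∨ s' = 2) ∧ s ≠ 1 ∧ s' ≠ 1) then ωgl * (secWt' cE cΛ s * secWt' cE cΛ s' * (((n : ℝ) ^ 8)⁻¹ *
          (toReal w μ * toReal w ν * biBubbleTable (Ga n a) (Ga n a) (secSt' n a cE cR cK cQ s) (secSt' n a cE cR cK cQ s') μ ν (b + w) b)))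
        else 0 := by
    rw [needleBub, sum_filter, ← sum4_prod (fun s s' r r' => if ((s = 2 ∨ s' = 2) ∧ s ≠ 1 ∧ s' ≠ 1) then ωgl * (secWt' cE cΛ s * secWt' cE cΛ s' *
      (((n : ℝ) ^ 8)⁻¹ * (toReal w μ * toReal w ν * biBubbleTable (legPiece n a g r) (legPiece n a g r') (secSt' n a cE cR cK cQ s)
        (secSt' n a cE cR cK cQ s') μ ν (b + w) b))) else 0)]
    refine sum_congr rfl fun s _ => sum_congr rfl fun s' _ => ?_
    by_cases hs : (s = 2 ∨ s' = 2) ∧ s ≠ 1 ∧ s' ≠ 1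
    · simp only [if_pos hs]
      rw [biBubbleTable_Ga_eq_pieceSum n a hGa hδ hg (hloc s) (hloc s') μ ν (b + w) b]
      simp only [mul_sum]
    · simp only [if_neg hs, sum_const_zero]
  rw [hind]
  have h01 : ((0 : Fin 3) = 1) ↔ False := by decide
  have h02 : ((0 : Fin 3) = 2) ↔ False := by decide
  have h12 : ((1 : Fin 3) = 2) ↔ False := by decide
  have h21 : ((2 : Fin 3) = 1) ↔ False := by decide
  simp only [Fin.sum_univ_three, Fin.isValue, ne_eq, h01, h02, h12, h21, or_false, or_true, not_false_eq_true, not_true_eq_false,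
    and_true, and_false, true_and, if_true, if_false, zero_add, add_zero, secWt'_zero, secWt'_two, secSt'_zero, secSt'_two, one_mul, mul_one]
  ring

/-- [folklore] Leg recombination for the 12 GHOST BUBBLE WORDS of the needle group at `(b, w)`: three two-sector tables over the full ghost leg,
`cK·cQ·(ghCur ⊗ qA) + cQ·cK·(qA ⊗ ghCur) + cQ·cQ·(qA ⊗ qA)`, `qA := qAntiAt (ctrHalf n) n`. -/
theorem sum_needleGhBub_restK' (ha : 0 < a) (hδ : 0 < δ) (hg : ∀ v, |g v| ≤ C * Real.exp (-δ * l1 v)) (w : Pt) :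
    ∑ y ∈ needleGhBub, restK' n a g cE cΛ cR cK cQ cE₂ cJ4 cΛ₂ cR₂ cQ₂ x₀ WE WJ WΛ WR WQ ωgl ωgh lam N μ ν b (Sum.inr (Sum.inr (Sum.inr (Sum.inl y)))) w
      = ωgh * (((n : ℝ) ^ 8)⁻¹ * (toReal w μ * toReal w ν *
          (cK * cQ * biBubbleTable (Ggh n a) (Ggh n a) ghCur (qAntiAt (ctrHalf n) n) μ ν (b + w) b
            + cQ * cK * biBubbleTable (Ggh n a) (Ggh n a) (qAntiAt (ctrHalf n) n) ghCur μ ν (b + w) b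
            + cQ * cQ * biBubbleTable (Ggh n a) (Ggh n a) (qAntiAt (ctrHalf n) n) (qAntiAt (ctrHalf n) n) μ ν (b + w) b))) := by
  have hloc : ∀ (i : Fin 2) (κ : Fin 4) (u : Site 4), Loc (ghSec n i κ u) := fun i κ u => loc_ghSec n i κ u
  have hword : ∀ y ∈ needleGhBub,
      restK' n a g cE cΛ cR cK cQ cE₂ cJ4 cΛ₂ cR₂ cQ₂ x₀ WE WJ WΛ WR WQ ωgl ωgh lam N μ ν b (Sum.inr (Sum.inr (Sum.inr (Sum.inl y)))) w
      = ωgh * (ghWt cK cQ y.1 * ghWt cK cQ y.2.1 * (((n : ℝ) ^ 8)⁻¹ * (toReal w μ * toReal w ν *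
          biBubbleTable (ghLeg n a g y.2.2.1) (ghLeg n a g y.2.2.2) (ghSec n y.1) (ghSec n y.2.1) μ ν (b + w) b))) := by
    intro y hy
    have hy' : y.1 = 1 ∨ y.2.1 = 1 := (mem_filter.1 hy).2
    have hne : y ≠ ((0 : Fin 2), (0 : Fin 2), (0 : Fin 2), (0 : Fin 2)) := by
      rintro rfl
      rcases hy' with h | h <;> exact absurd h (by decide)
    rw [restK'_gbub, if_neg hne]
    rfl
  rw [sum_congr rfl hword]
  have hind : ∑ y ∈ needleGhBub, ωgh * (ghWt cK cQ y.1 * ghWt cK cQ y.2.1 * (((n : ℝ) ^ 8)⁻¹ * (toReal w μ * toReal w ν *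
          biBubbleTable (ghLeg n a g y.2.2.1) (ghLeg n a g y.2.2.2) (ghSec n y.1) (ghSec n y.2.1) μ ν (b + w) b)))
      = ∑ i : Fin 2, ∑ j : Fin 2, if (i = 1 ∨ j = 1) then ωgh * (ghWt cK cQ i * ghWt cK cQ j * (((n : ℝ) ^ 8)⁻¹ *
          (toReal w μ * toReal w ν * biBubbleTable (Ggh n a) (Ggh n a) (ghSec n i) (ghSec n j) μ ν (b + w) b))) else 0 := by
    rw [needleGhBub, sum_filter, ← sum4_prod (fun i j r r' => if (i = 1 ∨ j = 1) then ωgh * (ghWt cK cQ i * ghWt cK cQ j *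
      (((n : ℝ) ^ 8)⁻¹ * (toReal w μ * toReal w ν * biBubbleTable (ghLeg n a g r) (ghLeg n a g r') (ghSec n i) (ghSec n j) μ ν (b + w) b))) else 0)]
    refine sum_congr rfl fun i _ => sum_congr rfl fun j _ => ?_
    by_cases hij : i = 1 ∨ j = 1
    · simp only [if_pos hij]
      rw [biBubbleTable_Ggh_eq_pieceSum n a ha hδ hg (hloc i) (hloc j) μ ν (b + w) b]
      simp only [mul_sum]
    · simp only [if_neg hij, sum_const_zero]
  rw [hind]
  have h01 : ((0 : Fin 2) = 1) ↔ False := by decide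
  simp only [Fin.sum_univ_two, Fin.isValue, h01, or_false, or_true, if_true, if_false, zero_add, ghWt_zero, ghWt_one, ghSec_zero, ghSec_one]
  ring

/-- [folklore] Leg recombination for the 3 SLOT-4 TADPOLE WORDS of the needle group at `(b, w)`: `ωgl·cQ₂·n⁻⁸·w_μw_ν·tadpoleTable n a WQ μ ν (b+w) b`. -/
theorem sum_needleTad_restK' (hGa : Spr (Ga n a)) (hδ : 0 < δ) (hg : ∀ v, |g v| ≤ C * Real.exp (-δ * l1 v)) (hδW : 0 < δW)
    (hQ : ∀ κ u l u', BiLoc (WQ κ u l u') u u' CQ δW) (w : Pt) :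
    ∑ r : Fin 3, restK' n a g cE cΛ cR cK cQ cE₂ cJ4 cΛ₂ cR₂ cQ₂ x₀ WE WJ WΛ WR WQ ωgl ωgh lam N μ ν b (Sum.inl ((4 : Fin 5), r)) w
      = ωgl * (cQ₂ * (((n : ℝ) ^ 8)⁻¹ * (toReal w μ * toReal w ν * tadpoleTable n a WQ μ ν (b + w) b))) := by
  have hWloc : ∀ κ u l u', Loc (WQ κ u l u') := fun κ u l u' => ⟨u, u', CQ, δW, hδW, hQ κ u l u'⟩
  have hword : ∀ r : Fin 3, restK' n a g cE cΛ cR cK cQ cE₂ cJ4 cΛ₂ cR₂ cQ₂ x₀ WE WJ WΛ WR WQ ωgl ωgh lam N μ ν b (Sum.inl ((4 : Fin 5), r)) w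
      = ωgl * (cQ₂ * (((n : ℝ) ^ 8)⁻¹ * (toReal w μ * toReal w ν * tadpoleTableA (legPiece n a g r) WQ μ ν (b + w) b))) := by
    intro r
    rw [restK'_tad]
    rfl
  simp only [hword, ← mul_sum]
  rw [tadpoleTable_eq_pieceSum n a hGa hδ hg hWloc μ ν (b + w) b]

/-- [folklore] **THE NEEDLE GROUP OF RE-CUT REST WORDS AT A BASE SITE AND A DISPLACEMENT IS THREE GLUON TABLES, THREE GHOST TABLES AND ONE SLOT-4 TADPOLE OVER
THE FULL LEGS** (owner (N-0)): for ANY exponentially bounded profile `g` (the frozen profile `gfrz n a b` in the END — it has DROPPED OUT on the right), `0 < a`,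
`Spr (Ga n a)`, the slot-4 table bi-localised at its bonds (`hQ`), every `μ ν b w`. -/
theorem sum_needleFibre_restK' (ha : 0 < a) (hGa : Spr (Ga n a)) (hδ : 0 < δ) (hg : ∀ v, |g v| ≤ C * Real.exp (-δ * l1 v)) (hδW : 0 < δW)
    (hQ : ∀ κ u l u', BiLoc (WQ κ u l u') u u' CQ δW) (w : Pt) :
    ∑ τ ∈ needleFibre, restK' n a g cE cΛ cR cK cQ cE₂ cJ4 cΛ₂ cR₂ cQ₂ x₀ WE WJ WΛ WR WQ ωgl ωgh lam N μ ν b τ w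
      = ((n : ℝ) ^ 8)⁻¹ * (toReal w μ * toReal w ν *
        (ωgl * (cE * biBubbleTable (Ga n a) (Ga n a) SbT (SbRc n a cE cR cK cQ) μ ν (b + w) b
            + cE * biBubbleTable (Ga n a) (Ga n a) (SbRc n a cE cR cK cQ) SbT μ ν (b + w) b
            + biBubbleTable (Ga n a) (Ga n a) (SbRc n a cE cR cK cQ) (SbRc n a cE cR cK cQ) μ ν (b + w) b)
          + ωgh * (cK * cQ * biBubbleTable (Ggh n a) (Ggh n a) ghCur (qAntiAt (ctrHalf n) n) μ ν (b + w) b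
            + cQ * cK * biBubbleTable (Ggh n a) (Ggh n a) (qAntiAt (ctrHalf n) n) ghCur μ ν (b + w) b
            + cQ * cQ * biBubbleTable (Ggh n a) (Ggh n a) (qAntiAt (ctrHalf n) n) (qAntiAt (ctrHalf n) n) μ ν (b + w) b)
          + ωgl * (cQ₂ * tadpoleTable n a WQ μ ν (b + w) b))) := by
  rw [sum_needleFibre, sum_needleBub_restK' n a cE cΛ cR cK cQ cE₂ cJ4 cΛ₂ cR₂ cQ₂ x₀ WE WJ WΛ WR WQ ωgl ωgh lam N μ ν b ha hGa hδ hg w,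
    sum_needleGhBub_restK' n a cE cΛ cR cK cQ cE₂ cJ4 cΛ₂ cR₂ cQ₂ x₀ WE WJ WΛ WR WQ ωgl ωgh lam N μ ν b ha hδ hg w,
    sum_needleTad_restK' n a cE cΛ cR cK cQ cE₂ cJ4 cΛ₂ cR₂ cQ₂ x₀ WE WJ WΛ WR WQ ωgl ωgh lam N μ ν b hGa hδ hg hδW hQ w]
  ring

end Pointwise

/-! ## §3 (v1.1, owner ruling ρ-g9-26) The needle fibre OF RECORD: with the two ghost tadpole words -/

open Summit.QuantumFields.BalabanUV.Beta.D1BFx.GhostAveragingSquare (WghAt)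
open Summit.QuantumFields.BalabanUV.Beta.D1BFx.FineHessianGhostGrades (loc_WghAt_ctr tadpoleTableA_Ggh_eq_pieceSum)
open Summit.QuantumFields.BalabanUV.Beta.D1BFx.SplitRecut (restK'_gtad)

/-- [our object] **THE NEEDLE FIBRE OF RECORD (owner ruling ρ-g9-26)**: `needleFibre` together with the two ghost TADPOLE words `Sum.inr (Sum.inr (Sum.inl r))`,
whose table `WghAt (ctrHalf n) n x₀ cK cQ = diagExt ((x₀·cK) • ghX) + (−(x₀·cQ·n⁴)) • qSqAt (ctrHalf n) n` carries the tower-side needle's averaging square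
`qSqAt = qAntiAt ⊗ qAntiAt` (weight `cQ`).  44 words.  A DEFINITION (data). -/
def needleFibre' : Finset RestIdx :=
  needleFibre ∪ (univ : Finset (Fin 2)).map ⟨fun r => Sum.inr (Sum.inr (Sum.inl r)),
    fun _ _ h => Sum.inl_injective (Sum.inr_injective (Sum.inr_injective h))⟩

/-- [our object] The v1 fibre is contained in the fibre of record. -/
theorem needleFibre_subset_needleFibre' : needleFibre ⊆ needleFibre' :=
  subset_union_left

/-- [our object] Membership: the ghost tadpole words ARE in the fibre of record. -/
theorem mem_needleFibre'_gtad (r : Fin 2) : (Sum.inr (Sum.inr (Sum.inl r)) : RestIdx) ∈ needleFibre' := by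
  simp [needleFibre']

/-- [our object] Membership: gluon bubble words (as for `needleFibre`). -/
theorem mem_needleFibre'_bub (x : Fin 3 × Fin 3 × Fin 3 × Fin 3) :
    (Sum.inr (Sum.inl x) : RestIdx) ∈ needleFibre' ↔ ((x.1 = 2 ∨ x.2.1 = 2) ∧ x.1 ≠ 1 ∧ x.2.1 ≠ 1) := by
  rw [← mem_needleFibre_bub]
  simp [needleFibre']

/-- [our object] Membership: ghost bubble words (as for `needleFibre`). -/
theorem mem_needleFibre'_gbub (y : Fin 2 × Fin 2 × Fin 2 × Fin 2) :
    (Sum.inr (Sum.inr (Sum.inr (Sum.inl y))) : RestIdx) ∈ needleFibre' ↔ (y.1 = 1 ∨ y.2.1 = 1) := by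
  rw [← mem_needleFibre_gbub]
  simp [needleFibre']

/-- [our object] Membership: gluon tadpole words — exactly the slot-4 ones (as for `needleFibre`). -/
theorem mem_needleFibre'_tad (x : Fin 5 × Fin 3) : (Sum.inl x : RestIdx) ∈ needleFibre' ↔ x.1 = 4 := by
  rw [← mem_needleFibre_tad]
  simp [needleFibre']

/-- [our object] No corner∕cross word is in the fibre of record. -/
theorem not_mem_needleFibre'_last (k : Fin 2) : (Sum.inr (Sum.inr (Sum.inr (Sum.inr k))) : RestIdx) ∉ needleFibre' := by
  simp [needleFibre', needleFibre]

/-- [folklore] **THE SUM OVER THE FIBRE OF RECORD = THE SUM OVER `needleFibre` + THE TWO GHOST TADPOLE WORDS** («27 + 12 + 3 + 2»). -/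
theorem sum_needleFibre' (f : RestIdx → ℝ) :
    ∑ τ ∈ needleFibre', f τ = (∑ τ ∈ needleFibre, f τ) + ∑ r : Fin 2, f (Sum.inr (Sum.inr (Sum.inl r))) := by
  rw [needleFibre', sum_union, sum_map]
  · rfl
  · rw [disjoint_right]
    intro τ h
    simp only [mem_map, Function.Embedding.coeFn_mk, mem_univ, true_and] at h
    obtain ⟨r, rfl⟩ := h
    exact not_mem_needleFibre_gtad r

/-- [folklore] **THE Λ-GROUP AND THE NEEDLE FIBRE OF RECORD ARE DISJOINT** (one label `grp : RestIdx → Fin 4` separates gΛ ∕ gN ∕ corner ∕ local). -/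
theorem disjoint_lamFibre_needleFibre' : Disjoint lamFibre needleFibre' := by
  rw [needleFibre', disjoint_union_right]
  refine ⟨disjoint_lamFibre_needleFibre, ?_⟩
  rw [disjoint_right]
  intro τ h
  simp only [mem_map, Function.Embedding.coeFn_mk, mem_univ, true_and] at h
  obtain ⟨r, rfl⟩ := h
  exact not_mem_lamFibre_inr_inr _

section PointwisePrime

variable (n : ℕ) [NeZero n] (a : ℝ) {g : Pt → ℝ} (cE cΛ cR cK cQ cE₂ cJ4 cΛ₂ cR₂ cQ₂ x₀ : ℝ) (WE WJ WΛ WR WQ : TableR)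
  (ωgl ωgh lam N : ℝ) (μ ν : Fin 4) (b : Pt) {C δ CQ δW : ℝ}

/-- [folklore] Leg recombination for the 2 GHOST TADPOLE WORDS at `(b, w)`: ONE tadpole of the completed ghost table over the full ghost leg,
`ωgh·n⁻⁸·w_μw_ν·tadpoleTableA (Ggh n a) (WghAt (ctrHalf n) n x₀ cK cQ) μ ν (b+w) b` (`tadpoleTableA_Ggh_eq_pieceSum` with `loc_WghAt_ctr`). -/
theorem sum_needleGhTad_restK' (ha : 0 < a) (hδ : 0 < δ) (hg : ∀ v, |g v| ≤ C * Real.exp (-δ * l1 v)) (w : Pt) :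
    ∑ r : Fin 2, restK' n a g cE cΛ cR cK cQ cE₂ cJ4 cΛ₂ cR₂ cQ₂ x₀ WE WJ WΛ WR WQ ωgl ωgh lam N μ ν b (Sum.inr (Sum.inr (Sum.inl r))) w
      = ωgh * (((n : ℝ) ^ 8)⁻¹ * (toReal w μ * toReal w ν * tadpoleTableA (Ggh n a) (WghAt (ctrHalf n) n x₀ cK cQ) μ ν (b + w) b)) := by
  have hword : ∀ r : Fin 2, restK' n a g cE cΛ cR cK cQ cE₂ cJ4 cΛ₂ cR₂ cQ₂ x₀ WE WJ WΛ WR WQ ωgl ωgh lam N μ ν b (Sum.inr (Sum.inr (Sum.inl r))) w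
      = ωgh * (((n : ℝ) ^ 8)⁻¹ * (toReal w μ * toReal w ν * tadpoleTableA (ghLeg n a g r) (WghAt (ctrHalf n) n x₀ cK cQ) μ ν (b + w) b)) := by
    intro r
    rw [restK'_gtad]
    rfl
  simp only [hword, ← mul_sum]
  rw [tadpoleTableA_Ggh_eq_pieceSum n a ha hδ hg (loc_WghAt_ctr n cK cQ x₀) μ ν (b + w) b]

/-- [folklore] **THE NEEDLE GROUP OF RECORD AT A BASE SITE AND A DISPLACEMENT IS THREE GLUON TABLES, THREE GHOST TABLES, THE COMPLETED GHOST TADPOLE AND THE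
SLOT-4 TADPOLE OVER THE FULL LEGS** (owner (N-0) with ruling ρ-g9-26): `sum_needleFibre_restK'` plus the eighth table of `sum_needleGhTad_restK'`; same
hypotheses (ANY exponentially bounded profile `g`, `0 < a`, `Spr (Ga n a)`, the slot-4 socket `hQ`), every `μ ν b w`. -/
theorem sum_needleFibre'_restK' (ha : 0 < a) (hGa : Spr (Ga n a)) (hδ : 0 < δ) (hg : ∀ v, |g v| ≤ C * Real.exp (-δ * l1 v)) (hδW : 0 < δW)
    (hQ : ∀ κ u l u', BiLoc (WQ κ u l u') u u' CQ δW) (w : Pt) :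
    ∑ τ ∈ needleFibre', restK' n a g cE cΛ cR cK cQ cE₂ cJ4 cΛ₂ cR₂ cQ₂ x₀ WE WJ WΛ WR WQ ωgl ωgh lam N μ ν b τ w
      = ((n : ℝ) ^ 8)⁻¹ * (toReal w μ * toReal w ν *
        (ωgl * (cE * biBubbleTable (Ga n a) (Ga n a) SbT (SbRc n a cE cR cK cQ) μ ν (b + w) b
            + cE * biBubbleTable (Ga n a) (Ga n a) (SbRc n a cE cR cK cQ) SbT μ ν (b + w) b
            + biBubbleTable (Ga n a) (Ga n a) (SbRc n a cE cR cK cQ) (SbRc n a cE cR cK cQ) μ ν (b + w) b)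
          + ωgh * (cK * cQ * biBubbleTable (Ggh n a) (Ggh n a) ghCur (qAntiAt (ctrHalf n) n) μ ν (b + w) b
            + cQ * cK * biBubbleTable (Ggh n a) (Ggh n a) (qAntiAt (ctrHalf n) n) ghCur μ ν (b + w) b
            + cQ * cQ * biBubbleTable (Ggh n a) (Ggh n a) (qAntiAt (ctrHalf n) n) (qAntiAt (ctrHalf n) n) μ ν (b + w) b
            + tadpoleTableA (Ggh n a) (WghAt (ctrHalf n) n x₀ cK cQ) μ ν (b + w) b)
          + ωgl * (cQ₂ * tadpoleTable n a WQ μ ν (b + w) b))) := by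
  rw [sum_needleFibre', sum_needleFibre_restK' n a cE cΛ cR cK cQ cE₂ cJ4 cΛ₂ cR₂ cQ₂ x₀ WE WJ WΛ WR WQ ωgl ωgh lam N μ ν b ha hGa hδ hg hδW hQ w,
    sum_needleGhTad_restK' n a cE cΛ cR cK cQ cE₂ cJ4 cΛ₂ cR₂ cQ₂ x₀ WE WJ WΛ WR WQ ωgl ωgh lam N μ ν b ha hδ hg w]
  ring

end PointwisePrime

end Summit.QuantumFields.BalabanUV.Beta.D1BFx.NeedleGroupPointwise

end
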